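import Mathlib
import HarnessLib
import Summits.HubbardSuperconductivity.HubbardSuperconductivity.Theorems.KLProgrammeDispersionFlowDefs

/-!
# Route `KLProgramme` (crux K3, stmt-HubbardSuperconductivity-19937) — transport: the `E_h`-clauses of (I_h) imply
# its `ε_h`-clauses (layer (α) ⟹ layer (β) of `KLProgrammeDispersionFlowDefs.lean`)

Cell `gate-hubbard-kl`, seat p2.  The invariant (I_h) (`DispersionFlow`) carries the per-scale bounds twice: on BGM's
carrier `E : ℤ → ℝ × (Fin 2 → ℝ) → ℂ` as coordinate mixed partials at the Matsubara frequencies (`IncrementBounds`, the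
shape of BGM06 (2.36)), and for the effective dispersion `ε_h = Re ½[E_h(π/β,·) + E_h(-π/β,·)]` on
`Momentum = EuclideanSpace ℝ (Fin 2)` as operator norms (`EffectiveStepBounds`, what Lemma 2.1 consumes).  This file
PROVES that the second follows from the first with absolute constants:

  `IncrementBounds β U C w hβ E` (+ smoothness of every `E_h(k₀,·)`, `C ≥ 0`, `w ≥ 0` on the scales)
  `⟹ EffectiveStepBounds β U (C 0) (2 C 1) (4 C 2) w hβ E`  (`effectiveStepBounds_of_incrementBounds`).

Ingredients: `±π/β ∈ D_β`; `|Re z| ≤ |z|`; the operator norm of a (bi)linear form on `(Fin 2 → ℝ, ‖·‖_∞)` is at most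
the sum of the absolute values of its `2` (resp. `4`) coordinate entries; composition with the coordinate map
`EuclideanSpace.equiv : Momentum →L (Fin 2 → ℝ)` (norm `≤ 1`) does not increase `‖Dᵇ·‖`
(`ContinuousLinearMap.iteratedFDeriv_comp_right`, `norm_compContinuousLinearMap_le`).  Everything PROVED; no
definitions. References: BGM06 (2.36), (2.36c), (2.41a) [BenfattoGiulianiMastropietro2006].
-/

noncomputable section

-- the tree's namespace `Summit.<Summit>.<Problem>.Theorems` repeats the summit name by design (D-0017)
set_option linter.dupNamespace false

namespace Summit.HubbardSuperconductivity.HubbardSuperconductivity.Theorems.DispersionFlow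

open Set Real
open scoped Topology
open Literature.MathematicalPhysics.QuantumLattice Literature.MathematicalPhysics.QuantumLattice.FermiRG

/-! ### Small tools on `(Fin 2 → ℝ, ‖·‖_∞)` -/

/-- `±π/β` are fermionic Matsubara frequencies (`n₀ = 0, -1`). -/
theorem pi_div_mem_matsubaraSet (β : ℝ) : π / β ∈ matsubaraSet β ∧ -(π / β) ∈ matsubaraSet β := by
  refine ⟨⟨0, ?_⟩, ⟨-1, ?_⟩⟩
  · simp only [fermiMatsubara]; push_cast; ring
  · simp only [fermiMatsubara]; push_cast; ring

/-- A vector of `Fin 2 → ℝ` in the coordinate basis. -/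
theorem pi_fin_two_eq (v : Fin 2 → ℝ) : v = v 0 • Pi.single 0 (1 : ℝ) + v 1 • Pi.single 1 (1 : ℝ) := by
  funext j
  fin_cases j <;> simp

/-- The operator norm of a linear form on `(Fin 2 → ℝ, ‖·‖_∞)` is at most the sum of its two entries. -/
theorem opNorm_le_of_fin_two (T : (Fin 2 → ℝ) →L[ℝ] ℝ) :
    ‖T‖ ≤ |T (Pi.single 0 1)| + |T (Pi.single 1 1)| := by
  refine ContinuousLinearMap.opNorm_le_bound _ (by positivity) fun v => ?_
  have h0 : |v 0| ≤ ‖v‖ := by simpa using norm_le_pi_norm v 0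
  have h1 : |v 1| ≤ ‖v‖ := by simpa using norm_le_pi_norm v 1
  conv_lhs => rw [pi_fin_two_eq v]
  rw [map_add, map_smul, map_smul, smul_eq_mul, smul_eq_mul, Real.norm_eq_abs]
  calc |v 0 * T (Pi.single 0 1) + v 1 * T (Pi.single 1 1)|
      ≤ |v 0| * |T (Pi.single 0 1)| + |v 1| * |T (Pi.single 1 1)| := by
        refine (abs_add_le _ _).trans ?_
        rw [abs_mul, abs_mul]
    _ ≤ ‖v‖ * |T (Pi.single 0 1)| + ‖v‖ * |T (Pi.single 1 1)| := by gcongr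
    _ = (|T (Pi.single 0 1)| + |T (Pi.single 1 1)|) * ‖v‖ := by ring

/-- The operator norm of a bilinear form on `(Fin 2 → ℝ, ‖·‖_∞)` is at most the sum of its four entries. -/
theorem opNorm_le_of_fin_two_two (B : (Fin 2 → ℝ) →L[ℝ] (Fin 2 → ℝ) →L[ℝ] ℝ) :
    ‖B‖ ≤ ∑ i : Fin 2, ∑ j : Fin 2, |B (Pi.single i 1) (Pi.single j 1)| := by
  refine ContinuousLinearMap.opNorm_le_bound _ (by positivity) fun v => ?_
  refine ContinuousLinearMap.opNorm_le_bound _ (by positivity) fun u => ?_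
  have hv : ∀ i, |v i| ≤ ‖v‖ := fun i => by simpa using norm_le_pi_norm v i
  have hu : ∀ j, |u j| ≤ ‖u‖ := fun j => by simpa using norm_le_pi_norm u j
  have hexp : B v u = ∑ i : Fin 2, ∑ j : Fin 2, v i * u j * B (Pi.single i 1) (Pi.single j 1) := by
    conv_lhs => rw [pi_fin_two_eq v, pi_fin_two_eq u]
    simp only [map_add, map_smul, add_apply, smul_apply, smul_eq_mul, Fin.sum_univ_two]
    ring
  rw [Real.norm_eq_abs, hexp]
  calc |∑ i : Fin 2, ∑ j : Fin 2, v i * u j * B (Pi.single i 1) (Pi.single j 1)|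
      ≤ ∑ i : Fin 2, ∑ j : Fin 2, |v i * u j * B (Pi.single i 1) (Pi.single j 1)| := by
        refine (Finset.abs_sum_le_sum_abs _ _).trans (Finset.sum_le_sum fun i _ => ?_)
        exact Finset.abs_sum_le_sum_abs _ _
    _ ≤ ∑ i : Fin 2, ∑ j : Fin 2, ‖v‖ * ‖u‖ * |B (Pi.single i 1) (Pi.single j 1)| := by
        refine Finset.sum_le_sum fun i _ => Finset.sum_le_sum fun j _ => ?_
        rw [abs_mul, abs_mul]
        gcongr
        · exact hv i
        · exact hu j
    _ = (∑ i : Fin 2, ∑ j : Fin 2, |B (Pi.single i 1) (Pi.single j 1)|) * ‖v‖ * ‖u‖ := by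
        rw [Finset.sum_mul, Finset.sum_mul]
        refine Finset.sum_congr rfl fun i _ => ?_
        rw [Finset.sum_mul, Finset.sum_mul]
        refine Finset.sum_congr rfl fun j _ => ?_
        ring

/-- The coordinate map `Momentum → (Fin 2 → ℝ)` has operator norm `≤ 1` (`|xᵢ| ≤ ‖x‖₂`). -/
theorem norm_euclideanSpace_equiv_le_one :
    ‖((EuclideanSpace.equiv (Fin 2) ℝ : Momentum ≃L[ℝ] (Fin 2 → ℝ)) : Momentum →L[ℝ] (Fin 2 → ℝ))‖ ≤ 1 := by
  refine ContinuousLinearMap.opNorm_le_bound _ zero_le_one fun x => ?_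
  rw [one_mul, pi_norm_le_iff_of_nonneg (norm_nonneg x)]
  intro i
  exact PiLp.norm_apply_le x i

/-! ### The averaged real part `ε_h` as a function on `Fin 2 → ℝ` -/

/-- `bgmTimeDiffIter β 0` is the identity (no time difference taken). -/
theorem bgmTimeDiffIter_zero (β : ℝ) (f : ℝ × (Fin 2 → ℝ) → ℂ) : bgmTimeDiffIter β 0 f = f := rfl

/-- The step `ε_h - ε_{h-1}` on `Fin 2 → ℝ` is `Re ∘ ½(ΔE(π/β,·) + ΔE(-π/β,·))`. -/
theorem bgmEffDisp_sub_eq (β : ℝ) (E : ℤ → ℝ × (Fin 2 → ℝ) → ℂ) (h : ℤ) :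
    (fun k => bgmEffDisp β E h k - bgmEffDisp β E (h - 1) k) =
      Complex.reCLM ∘ fun k => (2 : ℝ)⁻¹ • ((E h (π / β, k) - E (h - 1) (π / β, k)) +
        (E h (-(π / β), k) - E (h - 1) (-(π / β), k))) := by
  funext k
  simp only [bgmEffDisp, Function.comp_apply, Complex.reCLM_apply, ← Complex.sub_re]
  congr 1
  rw [Complex.real_smul]
  push_cast
  ring

variable {β U : ℝ} {C : ℕ → ℝ} {w : ℤ → ℝ} {hβ : ℤ} {E : ℤ → ℝ × (Fin 2 → ℝ) → ℂ}

/-- Smoothness of `ε_h` on `Fin 2 → ℝ` from the smoothness of `E_h(k₀, ·)`. -/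
theorem contDiff_bgmEffDisp (hsmooth : ∀ (h : ℤ) (k₀ : ℝ) (m : ℕ), ContDiff ℝ m (fun k : Fin 2 → ℝ => E h (k₀, k)))
    (h : ℤ) (m : ℕ) : ContDiff ℝ m (bgmEffDisp β E h) := by
  have : bgmEffDisp β E h = Complex.reCLM ∘ fun k => (2 : ℝ)⁻¹ • (E h (π / β, k) + E h (-(π / β), k)) := by
    funext k
    simp only [bgmEffDisp, Function.comp_apply, Complex.reCLM_apply]
    congr 1
    rw [Complex.real_smul]
    push_cast
    ring
  rw [this]
  exact Complex.reCLM.contDiff.comp (((hsmooth h _ m).add (hsmooth h _ m)).const_smul _)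

/-- **The coordinate-partial bounds of (I_h) control the step of `ε_h` on `Fin 2 → ℝ`**: for `h_β ≤ h ≤ 0` and the
step `s = ε_h - ε_{h-1}`: `|s(k)| ≤ C₀|U|w(h)γ^{2h}`, `‖Ds(k)‖ ≤ 2C₁U²w(h)γ^h`, `‖D²s(k)‖ ≤ 4C₂U²w(h)` (sup-norm
operator norms). -/
theorem step_bounds_pi (hsmooth : ∀ (h : ℤ) (k₀ : ℝ) (m : ℕ), ContDiff ℝ m (fun k : Fin 2 → ℝ => E h (k₀, k)))
    (hinc : IncrementBounds β U C w hβ E) {h : ℤ} (hh₁ : hβ ≤ h) (hh₂ : h ≤ 0) (k : Fin 2 → ℝ) :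
    |bgmEffDisp β E h k - bgmEffDisp β E (h - 1) k| ≤ C 0 * |U| * w h * (4 : ℝ) ^ (2 * h) ∧
    ‖iteratedFDeriv ℝ 1 (fun k => bgmEffDisp β E h k - bgmEffDisp β E (h - 1) k) k‖ ≤
      2 * C 1 * U ^ 2 * w h * (4 : ℝ) ^ h ∧
    ‖iteratedFDeriv ℝ 2 (fun k => bgmEffDisp β E h k - bgmEffDisp β E (h - 1) k) k‖ ≤ 4 * C 2 * U ^ 2 * w h := by
  obtain ⟨hmp, hmm⟩ := pi_div_mem_matsubaraSet β
  obtain ⟨h0, hn⟩ := hinc h hh₁ hh₂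
  -- the two complex step functions at `k₀ = ±π/β`
  set Dp : (Fin 2 → ℝ) → ℂ := fun k => E h (π / β, k) - E (h - 1) (π / β, k) with hDp
  set Dm : (Fin 2 → ℝ) → ℂ := fun k => E h (-(π / β), k) - E (h - 1) (-(π / β), k) with hDm
  have hDpC : ∀ m : ℕ, ContDiff ℝ m Dp := fun m => (hsmooth h _ m).sub (hsmooth (h - 1) _ m)
  have hDmC : ∀ m : ℕ, ContDiff ℝ m Dm := fun m => (hsmooth h _ m).sub (hsmooth (h - 1) _ m)
  set G : (Fin 2 → ℝ) → ℂ := fun k => (2 : ℝ)⁻¹ • (Dp k + Dm k) with hG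
  have hGC : ∀ m : ℕ, ContDiff ℝ m G := fun m => ((hDpC m).add (hDmC m)).const_smul _
  have hs : (fun k => bgmEffDisp β E h k - bgmEffDisp β E (h - 1) k) = Complex.reCLM ∘ G := by
    rw [bgmEffDisp_sub_eq]
  -- the real step function `s = Re ∘ G` and its coordinate mixed partials
  have hsC : ∀ m : ℕ, ContDiff ℝ m (fun k => bgmEffDisp β E h k - bgmEffDisp β E (h - 1) k) := fun m => by
    rw [hs]; exact Complex.reCLM.contDiff.comp (hGC m)
  have hmixed : ∀ (b : ℕ) (i : Fin b → Fin 2), 1 ≤ b → b ≤ 2 →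
      |iteratedFDeriv ℝ b (fun k => bgmEffDisp β E h k - bgmEffDisp β E (h - 1) k) k
          (fun j => Pi.single (i j) (1 : ℝ))| ≤ C b * U ^ 2 * w h * (4 : ℝ) ^ ((2 - (b : ℤ)) * h) := by
    intro b i hb1 hb2
    have hp := hn 0 b (by omega) i (π / β) hmp k
    have hq := hn 0 b (by omega) i (-(π / β)) hmm k
    simp only [bgmTimeDiffIter_zero, zero_add, mixedPartial] at hp hq
    rw [sq_abs] at hp hq
    change ‖iteratedFDeriv ℝ b Dp k (fun j => Pi.single (i j) (1 : ℝ))‖ ≤ _ at hp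
    change ‖iteratedFDeriv ℝ b Dm k (fun j => Pi.single (i j) (1 : ℝ))‖ ≤ _ at hq
    have hGk : iteratedFDeriv ℝ b G k = (2 : ℝ)⁻¹ • (iteratedFDeriv ℝ b Dp k + iteratedFDeriv ℝ b Dm k) := by
      rw [hG, iteratedFDeriv_const_smul_apply' (((hDpC b).add (hDmC b)).contDiffAt),
        show (fun x => Dp x + Dm x) = Dp + Dm from rfl,
        iteratedFDeriv_add_apply (hDpC b).contDiffAt (hDmC b).contDiffAt]
    have hsk : iteratedFDeriv ℝ b (fun k => bgmEffDisp β E h k - bgmEffDisp β E (h - 1) k) k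
        (fun j => Pi.single (i j) (1 : ℝ)) = (iteratedFDeriv ℝ b G k (fun j => Pi.single (i j) (1 : ℝ))).re := by
      rw [hs, Complex.reCLM.iteratedFDeriv_comp_left (hGC b).contDiffAt le_rfl]
      simp
    rw [hsk, hGk, smul_apply, add_apply]
    have hre := Complex.abs_re_le_norm ((2 : ℝ)⁻¹ • (iteratedFDeriv ℝ b Dp k (fun j => Pi.single (i j) (1 : ℝ)) +
      iteratedFDeriv ℝ b Dm k (fun j => Pi.single (i j) (1 : ℝ))))
    rw [norm_smul, norm_inv, Real.norm_ofNat] at hre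
    have hadd := norm_add_le (iteratedFDeriv ℝ b Dp k fun j => Pi.single (i j) (1 : ℝ))
      (iteratedFDeriv ℝ b Dm k fun j => Pi.single (i j) (1 : ℝ))
    nlinarith
  refine ⟨?_, ?_, ?_⟩
  · -- zeroth order
    have hp := h0 (π / β) hmp k
    have hq := h0 (-(π / β)) hmm k
    change ‖Dp k‖ ≤ _ at hp
    change ‖Dm k‖ ≤ _ at hq
    have hval : bgmEffDisp β E h k - bgmEffDisp β E (h - 1) k = (G k).re := by
      have := congrFun hs k
      simpa using this
    have hGk : G k = (2 : ℝ)⁻¹ • (Dp k + Dm k) := rfl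
    rw [hval, hGk]
    have hre := Complex.abs_re_le_norm ((2 : ℝ)⁻¹ • (Dp k + Dm k))
    rw [norm_smul, norm_inv, Real.norm_ofNat] at hre
    have hadd := norm_add_le (Dp k) (Dm k)
    nlinarith
  · -- first order: the two entries of `Ds(k)`
    rw [norm_iteratedFDeriv_one]
    refine (opNorm_le_of_fin_two _).trans ?_
    have h4 : (4 : ℝ) ^ ((2 - ((1 : ℕ) : ℤ)) * h) = (4 : ℝ) ^ h := by norm_num
    have e0 := hmixed 1 (fun _ => 0) le_rfl (by norm_num)
    have e1 := hmixed 1 (fun _ => 1) le_rfl (by norm_num)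
    rw [h4, iteratedFDeriv_one_apply] at e0 e1
    linarith
  · -- second order: the four entries of `D²s(k)`
    rw [← norm_iteratedFDeriv_fderiv, norm_iteratedFDeriv_one]
    refine (opNorm_le_of_fin_two_two _).trans ?_
    have h4 : (4 : ℝ) ^ ((2 - ((2 : ℕ) : ℤ)) * h) = 1 := by norm_num
    have hent : ∀ i j : Fin 2, |fderiv ℝ (fderiv ℝ (fun k => bgmEffDisp β E h k - bgmEffDisp β E (h - 1) k)) k
        (Pi.single i 1) (Pi.single j 1)| ≤ C 2 * U ^ 2 * w h := by
      intro i j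
      have e := hmixed 2 ![i, j] (by norm_num) le_rfl
      rw [h4, mul_one] at e
      have hvec : (fun t : Fin 2 => Pi.single ((![i, j] : Fin 2 → Fin 2) t) (1 : ℝ)) =
          ![Pi.single i (1 : ℝ), Pi.single j (1 : ℝ)] := by
        funext t; fin_cases t <;> rfl
      rw [hvec, iteratedFDeriv_two_apply] at e
      simpa using e
    simp only [Fin.sum_univ_two]
    linarith [hent 0 0, hent 0 1, hent 1 0, hent 1 1]

/-- **Layer (α) ⟹ layer (β)**: the coordinate-partial bounds of (2.36)-with-weight on BGM's carrier, together with the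
smoothness of every `E_h(k₀, ·)`, give the operator-norm per-scale bounds for the effective dispersion on `Momentum`
with the absolute constants `A₀ = C₀`, `A₁ = 2C₁`, `A₂ = 4C₂`. -/
theorem effectiveStepBounds_of_incrementBounds
    (hsmooth : ∀ (h : ℤ) (k₀ : ℝ) (m : ℕ), ContDiff ℝ m (fun k : Fin 2 → ℝ => E h (k₀, k)))
    (hinc : IncrementBounds β U C w hβ E) :
    EffectiveStepBounds β U (C 0) (2 * C 1) (4 * C 2) w hβ E := by
  set L : Momentum →L[ℝ] (Fin 2 → ℝ) :=
    ((EuclideanSpace.equiv (Fin 2) ℝ : Momentum ≃L[ℝ] (Fin 2 → ℝ)) : Momentum →L[ℝ] (Fin 2 → ℝ)) with hL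
  have hLnorm : ‖L‖ ≤ 1 := norm_euclideanSpace_equiv_le_one
  have hLapply : ∀ q : Momentum, L q = WithLp.ofLp q := fun q => rfl
  have heff : ∀ j : ℤ, effDisp β E j = bgmEffDisp β E j ∘ L := fun j => by
    funext q; simp [effDisp, hLapply]
  refine ⟨fun h _ => ?_, fun h hh₁ hh₂ p => ?_⟩
  · rw [heff]
    exact (contDiff_bgmEffDisp hsmooth h 2).comp L.contDiff
  · have hstep : (fun q => effDisp β E h q - effDisp β E (h - 1) q) =
        (fun k => bgmEffDisp β E h k - bgmEffDisp β E (h - 1) k) ∘ L := by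
      funext q; simp [effDisp, hLapply]
    obtain ⟨b0, b1, b2⟩ := step_bounds_pi hsmooth hinc hh₁ hh₂ (L p)
    have hsC : ContDiff ℝ 2 (fun k => bgmEffDisp β E h k - bgmEffDisp β E (h - 1) k) :=
      (contDiff_bgmEffDisp hsmooth h 2).sub (contDiff_bgmEffDisp hsmooth (h - 1) 2)
    have hcomp : ∀ b ≤ 2, ‖iteratedFDeriv ℝ b (fun q => effDisp β E h q - effDisp β E (h - 1) q) p‖ ≤
        ‖iteratedFDeriv ℝ b (fun k => bgmEffDisp β E h k - bgmEffDisp β E (h - 1) k) (L p)‖ := by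
      intro b hb
      rw [hstep, L.iteratedFDeriv_comp_right hsC p (by exact_mod_cast hb)]
      refine (ContinuousMultilinearMap.norm_compContinuousLinearMap_le _ _).trans ?_
      have hprod : ∏ _i : Fin b, ‖L‖ ≤ 1 := Finset.prod_le_one (fun _ _ => norm_nonneg _) fun _ _ => hLnorm
      exact mul_le_of_le_one_right (norm_nonneg _) hprod
    refine ⟨?_, (hcomp 1 (by norm_num)).trans b1, (hcomp 2 le_rfl).trans b2⟩
    have : effDisp β E h p - effDisp β E (h - 1) p = bgmEffDisp β E h (L p) - bgmEffDisp β E (h - 1) (L p) := by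
      simp [effDisp, hLapply]
    rw [this]
    exact b0

end Summit.HubbardSuperconductivity.HubbardSuperconductivity.Theorems.DispersionFlow

end
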